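import Literature.Analysis.ODE.MeasurablePicardLindelof
import Mathlib

/-!
# Dimock–Yuan: the reduction of Theorem 4 (the complete RG flow) to an ordinary differential
equation — §4.2 (etc) ⇔ (approx1) and §4.5 (boo) + (hoo) ⇒ (stunning), PROVED model-free

**Citation header (reproduction of PUBLISHED work; template file of the Balaban lattice Yang–Mills
cell `pub-balaban`, TEMPLATE.md §16.2; no manuscript under audit is touched).**
J. Dimock, C. Yuan, *Structural stability of the RG flow in the Gross–Neveu model*,
Ann. Henri Poincaré **25** (2024), doi 10.1007/s00023-024-01427-0 (= arXiv:2303.07916v3)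
[DimockYuan2024GNFlow], section *"The flow"* = **§4 of arXiv v3** (TeX l. 3274): §4.2 *"Reduction of the
problem"* (l. 3414, printed p. 57) — the interpolated step (etc) `x_{k+1} = Φ^t_k(x_k) = (σ_k(x_k), φ̄_k(x_k) +
tρ_k(x_k))` (l. 3472, printed eq. (381), p. 58), *"This interpolates between `Φ^0_k(x_k) = Φ̄_k(x_k)` and
`Φ^1_k(x_k) = Φ_k(x_k)`"* (l. 3475), the ODE (approx1) `ẋ_{k+1}(t) = (D_xΦ^t_k(x_k(t)))ẋ_k(t) + (0, ρ_k(x_k(t)))`,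
`x_k(0) = x̄_k` (l. 3482, printed (382)) and the sentence *"Conversely a solution of (approx1) gives a solution of
(etc)."* (l. 3485) —, Theorem 4 \label{another} (ll. 3279–3296, p. 55: the flow equations (stunning) with the
boundary conditions (BC) `g_N = g_f, ε_N = 0 and E_0 = 0, z_0 = 0, p_0 = 0, v_0 = 0`) and §4.5 *"Proof of
theorem 4"* (l. 4033, pp. 67–68): (boo) `(S(t,x)ρ(x))_{k+1} = D_xΦ_k(t,x_k)(S(t,x)ρ(x))_k + (0, ρ_k(x))` with null
boundary conditions (l. 4037, printed (449)), (hoo) `ẋ_k = F_k(t,x) ≡ (S(t,x)ρ(x))_k`, `x_k(0) = x̄_k` (l. 4042,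
(450)), *"The null boundary conditions for `S(t,x)ρ(x)` imply null boundary condition for `ẋ_k(t)` … This means
that `x_k(t)` has constant boundary conditions, and since `x_k(0) = x̄_k` satisfies the boundary conditions
(BC), the same is true for `x(t)`"* (ll. 4045–4048), *"Now taking the sequence `x_k = x_k(t)` in (boo) we have
`ẋ_{k+1}(t) = D_xΦ_k(t,x_k(t))ẋ_k(t) + (0, ρ_k(x_k(t)))`.  By uniqueness of such solutions `x_{k+1}(t) =
Φ^t_k(x(t))` ⟦sic: `x_k(t)`⟧.  In particular `x_k ≡ x_k(1)`, still in `x̄ + ⅛𝓑_{C_E}`, satisfies (singsong1) `x_{k+1} =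
Φ_k(x_k)` and hence (stunning) with the boundary conditions (BC)"* (ll. 4050–4056, printed (451)), *"Thus the
problem is reduced to the existence of solutions to (hoo) which is an ordinary differential equation in the
Banach space `X_w`.  We need a solution `x(t)` in the domain `x̄ + ⅛𝓑_{C_E}` with `x(0) = x̄` and defined for
at least `0 ≤ t ≤ 1`.  By a fundamental theorem of ODE there is a unique solution provided
`‖F(t,x)‖_{X_w} < ⅛C_E` for `x ∈ x̄ + ⅛𝓑` and `F` satisfies Lipschitz condition on this domain.  (See for
example [AbMa78])"* (ll. 4058–4060), and the bound *"`‖F(t,x)‖_{X_w} ≤ ‖S(t,x)‖_{𝓛(X_r,X_w)}‖ρ(x)‖_{X_r} ≤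
CC_Eh⁻² < ⅛C_E`"* for `h` sufficiently large from `‖ρ(x)‖_{X_r} ≤ 2C_Eh⁻²` (ll. 4062–4070).  TeX line numbers
refer to the cell's held source `inputs/files/dimock/src/2303.07916/2303.07916.tex`; page and equation numbers
are those of the arXiv-v3 PDF (text layer, `inputs/files/dimock/2303.07916.pdf`); printed-equation concordance
(XREAD C-lit2g20-3, I3): (stunning) = (360), (BC) = (361), (singsong1) = (377), (singsong2) = (378), (entire) = (380),
(etc) = (381), (approx1) = (382), (bc0) = (384), (boo) = (449), (hoo) = (450), the display ll. 4052–4054 = (451),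
`‖ρ‖` l. 4066 = (452), `‖F‖` l. 4070 = (453); [AbMa78] prints as [1].

**What is PROVED here, MODEL-FREE** (Mathlib + the tree's `Literature.Analysis.ODE.MeasurablePicardLindelof`
— Mathlib's Picard–Lindelöf theorem packaged with confinement to the ball, reused by name —; the Banach space
`X_w` of sequences is an arbitrary real normed space `𝕏` (complete where the ODE is solved), the components
`x ↦ x_k` are arbitrary continuous linear maps `π_k : 𝕏 →L[ℝ] X_k` into normed spaces `X_k`, the step is
`Φ^t_k(ξ) = Φb_k(ξ) + t • ρ_k(ξ)` for arbitrary maps `Φb_k, ρ_k : X_k → X_{k+1}` differentiable where needed —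
so D10's `Φ̄_k = (σ_k, φ̄_k)` and `(0, ρ_k)` are the instance, and nothing of D10's norms `𝒢_{h,Γ}` is
modelled):
* Part 1 — ONE STEP, (approx1) ⇔ (etc) along a differentiable curve: `hasDerivWithinAt_interpolatedStep`
  (the chain rule `d/dt Φ^t(x(t)) = (DΦb(x(t)) + tDρ(x(t)))ẋ(t) + ρ(x(t))`, i.e. `D_xΦ^t(x(t))ẋ(t) +
  ρ(x(t))`), `hasDerivWithinAt_of_step_eq` (l. 3479–3483: (etc) ⇒ (approx1)) and
  **`step_eq_of_hasDerivWithinAt`** (l. 3485 / l. 4055: (approx1) with `x_{k+1}(0) = Φ̄_k(x_k(0))` ⇒ (etc) for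
  all `t ∈ [0,1]` — *"by uniqueness of such solutions"* = two functions with the same right derivative and the
  same initial value agree, Mathlib `eq_of_has_deriv_right_eq`).
* Part 2 — BOUNDARY CONDITIONS (ll. 4045–4048): `apply_eq_of_null_deriv` — a continuous linear "boundary
  component" `b` with `b(ẋ(t)) = 0` on `[0,1)` is constant along the curve (`constant_of_has_deriv_right_zero`).
* Part 3 — THE ODE STEP (ll. 4058–4060, the *"fundamental theorem of ODE"*, here Mathlib's Picard–Lindelöf
  theorem instead of [AbMa78]): **`ode_exists_mem_closedBall`** — if on `[0,1] × closedBall x̄ R` the field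
  `F` is `K`-Lipschitz in `x`, continuous in `t` and bounded in norm by the radius `R` (the print's
  `‖F‖ < ⅛C_E` on `x̄ + ⅛𝓑_{C_E}`; `≤` suffices), there is a solution of `ẋ = F(t,x)`, `x(0) = x̄` on `[0,1]`
  staying in the closed ball — and `ode_unique_of_mem_closedBall` (uniqueness among solutions in the ball,
  Mathlib `ODE_solution_unique_of_mem_Icc_right`).
* Part 4 — (boo) + (hoo) ⇒ (stunning) (ll. 4050–4056): **`flow_of_ode`** — if `F` satisfies the component
  identity (boo) `π_{k+1}(F(t,x)) = D_xΦ^t_k(π_k x)(π_k F(t,x)) + ρ_k(π_k x)` on the domain, then along ANY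
  solution of (hoo) in the domain with `π_{k+1}(x(0)) = Φb_k(π_k(x(0)))` one has `π_{k+1}(x(t)) =
  Φ^t_k(π_k(x(t)))` for all `t ∈ [0,1]` and `k < N`; `flow_of_ode_one`: at `t = 1`, (singsong1)
  `x_{k+1} = Φb_k(x_k) + ρ_k(x_k) = Φ_k(x_k)`.
* Part 5 — the norm arithmetic of ll. 4062–4070 with the print's *"for `h` sufficiently large"* EXPLICIT:
  `norm_field_le` — `‖S‖ ≤ C`, `‖r‖ ≤ 2C_Eh⁻²`, `16C ≤ h²` ⇒ `‖S r‖ ≤ ⅛C_E`.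
* Part 6 — ASSEMBLY **`DimockYuan2024_thm4_mechanism`**: under Part 3's hypotheses on `F` over the closed
  ball of radius `R` about `x̄`, (boo) on that ball, and `x̄` a solution of the approximate flow
  (`π_{k+1} x̄ = Φb_k(π_k x̄)`, (singsong2) l. 3455), there is an ODE path `x(t)` from `x̄`, confined to the ball,
  whose endpoint `x(1)` solves the full flow (singsong1) for every `k < N` and has the same value as `x̄` under
  every continuous linear `b` annihilating `F` on the ball (the boundary conditions (BC)).

**What is NOT formalised (declared).**  That D10's actual field `F(t,x) = S(t,x)ρ(x)` — `S(t,x) =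
(1 − S⁰𝒲(t,x))⁻¹S⁰` of Lemma 22 (the sibling `SecondLinearEquation.DimockYuan2024_lemma22_mechanism` gives this
operator and its bound `‖S‖ ≤ 2C` model-free) composed with the remainders `ρ_k = (g*_k, z*_k, p*_k, v*_k)` of
Theorem 1 — satisfies the Lipschitz/continuity hypotheses of Part 3 is the print's analyticity paragraph
(ll. 4073–4076, resting on *"the proof of corollary 1"* (\label{cor}, l. 3209, p. 54; l. 3224: `E*_k` analytic in `E_k`) and on
*"the various terms in `𝒲_k` in the proof of lemma 21"* (`𝒲^{(I)}`, `𝒲^{(II)}`, ll. 3833–3837) — objects measured in D10's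
`𝒢_{h,Γ}` norms; v1 wrote «Lemma 21's first three lines in the `𝒢_{h,Γ}` norms», re-worded after XREAD C-lit2g20-3 (D2):
Lemma 21 itself is four `𝓛(X_w,X_r)` bounds); it enters here only as the hypotheses `hlip`, `hcont`, `hbdd`, and (boo) as the hypothesis `hboo` (by definition of
`S(t,x)` as the solution operator of (lumbar) with `D_xΦ_k(t,x_k) = D_xΦ̄_k(x_k) + tD_xρ_k(x_k)`).  Uniqueness of
the flow (Theorem 4 says *"unique solution"*) is not derived here.  The vacuum-energy component `ε_k` (ll.
4079–4088) is the sibling's `SecondLinearEquation.vacuumEnergy_final_zero`.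

Versions: v1 p191595; v1.1 = XREAD C-lit2g20-3 fold (beta-lit2-g20: ok ∣ ABSOLUTE-RULE 0 ∣ misquotations 1/24 ∣
kernel ✓ ∣ DOCFIX-LOW 2 ∣ INFO 5): D1 (an elided clause restored in the quotation of l. 3480), D2 (the analyticity
sentence re-worded), I1 (⟦sic⟧), I3 (equation concordance), I5 (`Z`'s universe pinned in
`DimockYuan2024_thm4_mechanism`; all other declarations unchanged).

References: [DimockYuan2024GNFlow] as above; [AbMa78] = R. Abraham, J. Marsden, *Foundations of Mechanics*
(Benjamin Cummings 1978), cited by the source for the ODE theorem (TeX l. 4597) — replaced here by Mathlib's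
`IsPicardLindelof`.
-/

noncomputable section

open Set Metric Filter Topology

open scoped NNReal

namespace Literature.MathematicalPhysics.QuantumFieldTheory.DimockYuan2024.FlowReduction

/-! ### Part 1.  One step: (approx1) ⇔ (etc) along a differentiable curve (§4.2, ll. 3472–3485) -/

section OneStep

variable {X Y : Type*} [NormedAddCommGroup X] [NormedSpace ℝ X] [NormedAddCommGroup Y]
  [NormedSpace ℝ Y]

/-- The chain rule behind (approx1) (TeX ll. 3479–3483, p. 58: *"differentiating `x_{k+1}(t) = Φ^t_k(x_k(t)) ≡
Φ_k(t,x_k(t))` we have a solution to the ODE `ẋ_{k+1}(t) = (D_xΦ^t_k(x_k(t)))ẋ_k(t) + (0, ρ_k(x_k(t)))`"*),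
model-free: along a
curve `x` with (one-sided) derivative `x'` at `t`, the interpolated step `τ ↦ Φb(x(τ)) + τ • ρ(x(τ))` has derivative
`(DΦb + t • Dρ)(x') + ρ(x(t))` — `DΦb + tDρ` being `D_xΦ^t` at `x(t)`.
[cite: DimockYuan2024GNFlow, §4.2 (approx1), TeX l. 3482] -/
theorem hasDerivWithinAt_interpolatedStep {Φb ρ : X → Y} {DΦb Dρ : X →L[ℝ] Y} {x : ℝ → X} {x' : X}
    {s : Set ℝ} {t : ℝ} (hΦ : HasFDerivAt Φb DΦb (x t)) (hρ : HasFDerivAt ρ Dρ (x t))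
    (hx : HasDerivWithinAt x x' s t) :
    HasDerivWithinAt (fun τ => Φb (x τ) + τ • ρ (x τ)) ((DΦb + t • Dρ) x' + ρ (x t)) s t := by
  have h1 : HasDerivWithinAt (fun τ => Φb (x τ)) (DΦb x') s t := hΦ.comp_hasDerivWithinAt t hx
  have h2 : HasDerivWithinAt (fun τ => ρ (x τ)) (Dρ x') s t := hρ.comp_hasDerivWithinAt t hx
  have h3 : HasDerivWithinAt (fun τ : ℝ => τ • ρ (x τ)) (t • Dρ x' + (1 : ℝ) • ρ (x t)) s t :=
    (hasDerivWithinAt_id t s).smul h2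
  have h := h1.add h3
  refine h.congr_deriv ?_
  simp only [add_apply, smul_apply, one_smul]
  abel

/-- (etc) ⇒ (approx1) (TeX ll. 3479–3483, p. 58), model-free: if `y(τ) = Φb(x(τ)) + τ • ρ(x(τ))` on `[0,1]`
then `y` solves the linear ODE `ẏ(t) = (DΦb(x(t)) + tDρ(x(t)))ẋ(t) + ρ(x(t))` within `[0,1]`.
[cite: DimockYuan2024GNFlow, §4.2 (approx1), TeX l. 3482] -/
theorem hasDerivWithinAt_of_step_eq {Φb ρ : X → Y} {DΦb Dρ : X → (X →L[ℝ] Y)} {x x' : ℝ → X}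
    {y : ℝ → Y} (hΦ : ∀ t ∈ Icc (0 : ℝ) 1, HasFDerivAt Φb (DΦb (x t)) (x t))
    (hρ : ∀ t ∈ Icc (0 : ℝ) 1, HasFDerivAt ρ (Dρ (x t)) (x t))
    (hx : ∀ t ∈ Icc (0 : ℝ) 1, HasDerivWithinAt x (x' t) (Icc (0 : ℝ) 1) t)
    (hy : ∀ t ∈ Icc (0 : ℝ) 1, y t = Φb (x t) + t • ρ (x t)) :
    ∀ t ∈ Icc (0 : ℝ) 1,
      HasDerivWithinAt y ((DΦb (x t) + t • Dρ (x t)) (x' t) + ρ (x t)) (Icc (0 : ℝ) 1) t := by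
  intro t ht
  exact (hasDerivWithinAt_interpolatedStep (hΦ t ht) (hρ t ht) (hx t ht)).congr_of_mem
    (fun τ hτ => hy τ hτ) ht

/-- **(approx1) ⇒ (etc), one step** — §4.2, TeX l. 3485, p. 58: *"Conversely a solution of (approx1) gives a
solution of (etc)"*, and §4.5, l. 4055, p. 67: *"By uniqueness of such solutions `x_{k+1}(t) = Φ^t_k(x(t))`"* —
MODEL-FREE: if `y` solves `ẏ(t) = D_xΦ^t(x(t))ẋ(t) + ρ(x(t))` within `[0,1]` along a curve `x` (with
`D_xΦ^t = DΦb + tDρ` the derivative of `Φ^t = Φb + tρ` at `x(t)`) and `y(0) = Φb(x(0)) = Φ^0(x(0))`, then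
`y(t) = Φ^t(x(t)) = Φb(x(t)) + t • ρ(x(t))` for all `t ∈ [0,1]`.  Proof as printed: both sides solve the same
equation with the same initial value (Mathlib `eq_of_has_deriv_right_eq`).
[cite: DimockYuan2024GNFlow, §4.2 l. 3485; §4.5 l. 4055] -/
theorem step_eq_of_hasDerivWithinAt {Φb ρ : X → Y} {DΦb Dρ : X → (X →L[ℝ] Y)} {x x' : ℝ → X}
    {y : ℝ → Y} (hΦ : ∀ t ∈ Icc (0 : ℝ) 1, HasFDerivAt Φb (DΦb (x t)) (x t))
    (hρ : ∀ t ∈ Icc (0 : ℝ) 1, HasFDerivAt ρ (Dρ (x t)) (x t))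
    (hx : ∀ t ∈ Icc (0 : ℝ) 1, HasDerivWithinAt x (x' t) (Icc (0 : ℝ) 1) t)
    (hy : ∀ t ∈ Icc (0 : ℝ) 1,
      HasDerivWithinAt y ((DΦb (x t) + t • Dρ (x t)) (x' t) + ρ (x t)) (Icc (0 : ℝ) 1) t)
    (h0 : y 0 = Φb (x 0)) :
    ∀ t ∈ Icc (0 : ℝ) 1, y t = Φb (x t) + t • ρ (x t) := by
  have hz : ∀ t ∈ Icc (0 : ℝ) 1, HasDerivWithinAt (fun τ => Φb (x τ) + τ • ρ (x τ))
      ((DΦb (x t) + t • Dρ (x t)) (x' t) + ρ (x t)) (Icc (0 : ℝ) 1) t :=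
    fun t ht => hasDerivWithinAt_interpolatedStep (hΦ t ht) (hρ t ht) (hx t ht)
  refine eq_of_has_deriv_right_eq
    (f' := fun t => (DΦb (x t) + t • Dρ (x t)) (x' t) + ρ (x t))
    (fun t ht => (hy t (mem_Icc_of_Ico ht)).mono_of_mem_nhdsWithin (Icc_mem_nhdsGE_of_mem ht))
    (fun t ht => (hz t (mem_Icc_of_Ico ht)).mono_of_mem_nhdsWithin (Icc_mem_nhdsGE_of_mem ht))
    (fun t ht => (hy t ht).continuousWithinAt) (fun t ht => (hz t ht).continuousWithinAt) ?_
  simp [h0]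

/-- At `t = 1` the interpolated step is the full step: `Φ^1 = Φb + ρ = Φ` (TeX l. 3475, *"`Φ^1_k(x_k) =
Φ_k(x_k)`"*); so under the hypotheses of `step_eq_of_hasDerivWithinAt`, `y(1) = Φb(x(1)) + ρ(x(1))`.
[cite: DimockYuan2024GNFlow, §4.2 l. 3475; §4.5 l. 4055] -/
theorem step_eq_one_of_hasDerivWithinAt {Φb ρ : X → Y} {DΦb Dρ : X → (X →L[ℝ] Y)} {x x' : ℝ → X}
    {y : ℝ → Y} (hΦ : ∀ t ∈ Icc (0 : ℝ) 1, HasFDerivAt Φb (DΦb (x t)) (x t))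
    (hρ : ∀ t ∈ Icc (0 : ℝ) 1, HasFDerivAt ρ (Dρ (x t)) (x t))
    (hx : ∀ t ∈ Icc (0 : ℝ) 1, HasDerivWithinAt x (x' t) (Icc (0 : ℝ) 1) t)
    (hy : ∀ t ∈ Icc (0 : ℝ) 1,
      HasDerivWithinAt y ((DΦb (x t) + t • Dρ (x t)) (x' t) + ρ (x t)) (Icc (0 : ℝ) 1) t)
    (h0 : y 0 = Φb (x 0)) :
    y 1 = Φb (x 1) + ρ (x 1) := by
  have h := step_eq_of_hasDerivWithinAt hΦ hρ hx hy h0 1 (right_mem_Icc.2 zero_le_one)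
  simpa using h

end OneStep

/-! ### Part 2.  Boundary conditions are constant along the path (§4.5, ll. 4045–4048) -/

section Boundary

variable {X Z : Type*} [NormedAddCommGroup X] [NormedSpace ℝ X] [NormedAddCommGroup Z]
  [NormedSpace ℝ Z]

/-- **Null boundary conditions for `ẋ` ⇒ constant boundary conditions for `x`** (TeX ll. 4045–4048, p. 67:
*"The null boundary conditions for `S(t,x)ρ(x)` imply null boundary condition for `ẋ_k(t)`.  (That is
`ġ_N(t) = 0, Ė_0(t) = 0, …`.)  This means that `x_k(t)` has constant boundary conditions"*), MODEL-FREE: for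
any continuous linear `b : X →L[ℝ] Z` (a "boundary component": `x ↦ g_N`, `x ↦ E_0`, …) with `b(ẋ(t)) = 0`
on `[0,1)`, `b(x(t)) = b(x(0))` on `[0,1]`.
[cite: DimockYuan2024GNFlow, §4.5, TeX ll. 4045–4048] -/
theorem apply_eq_of_null_deriv (b : X →L[ℝ] Z) {x x' : ℝ → X}
    (hx : ∀ t ∈ Icc (0 : ℝ) 1, HasDerivWithinAt x (x' t) (Icc (0 : ℝ) 1) t)
    (hb : ∀ t ∈ Ico (0 : ℝ) 1, b (x' t) = 0) :
    ∀ t ∈ Icc (0 : ℝ) 1, b (x t) = b (x 0) := by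
  have hd : ∀ t ∈ Icc (0 : ℝ) 1,
      HasDerivWithinAt (fun τ => b (x τ)) (b (x' t)) (Icc (0 : ℝ) 1) t :=
    fun t ht => b.hasFDerivAt.comp_hasDerivWithinAt t (hx t ht)
  refine constant_of_has_deriv_right_zero (f := fun τ => b (x τ))
    (fun t ht => (hd t ht).continuousWithinAt) ?_
  intro t ht
  have h := (hd t (mem_Icc_of_Ico ht)).mono_of_mem_nhdsWithin (Icc_mem_nhdsGE_of_mem ht)
  rwa [hb t ht] at h

end Boundary

/-! ### Part 3.  The ODE step in the ball (§4.5, ll. 4058–4060) -/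

section ODE

variable {𝕏 : Type*} [NormedAddCommGroup 𝕏] [NormedSpace ℝ 𝕏]

/-- **The "fundamental theorem of ODE" as used at TeX ll. 4058–4060, p. 67** (*"We need a solution `x(t)` in
the domain `x̄ + ⅛𝓑_{C_E}` with `x(0) = x̄` and defined for at least `0 ≤ t ≤ 1`.  By a fundamental theorem of
ODE there is a unique solution provided `‖F(t,x)‖_{X_w} < ⅛C_E` for `x ∈ x̄ + ⅛𝓑` and `F` satisfies Lipschitz
condition on this domain"*), MODEL-FREE, in a complete space, with the radius `R` for `⅛C_E` (and `≤ R` for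
the print's `< ⅛C_E`): existence on `[0,1]` of a solution from the centre, CONFINED to the closed ball (the
print's *"still in `x̄ + ⅛𝓑_{C_E}`"*, l. 4055).  Mathlib's Picard–Lindelöf theorem (`IsPicardLindelof` with
`a = R`, `r = 0`, `L = R`, time `1`), through the tree's `Literature.Analysis.ODE.picardSolution` /
`picardSolution_mem_closedBall` (reused by name), replaces the source's reference [AbMa78]; continuity of
`t ↦ F(t,x)` is the (implicit) time-regularity hypothesis.
[cite: DimockYuan2024GNFlow, §4.5, TeX ll. 4058–4060] -/
theorem ode_exists_mem_closedBall [CompleteSpace 𝕏] (F : ℝ → 𝕏 → 𝕏) (xb : 𝕏) (R K : ℝ≥0)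
    (hlip : ∀ t ∈ Icc (0 : ℝ) 1, LipschitzOnWith K (F t) (closedBall xb R))
    (hcont : ∀ x ∈ closedBall xb (R : ℝ), ContinuousOn (F · x) (Icc (0 : ℝ) 1))
    (hbdd : ∀ t ∈ Icc (0 : ℝ) 1, ∀ x ∈ closedBall xb (R : ℝ), ‖F t x‖ ≤ R) :
    ∃ x : ℝ → 𝕏, x 0 = xb ∧ (∀ t, x t ∈ closedBall xb (R : ℝ)) ∧
      ∀ t ∈ Icc (0 : ℝ) 1, HasDerivWithinAt x (F t (x t)) (Icc (0 : ℝ) 1) t := by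
  set t₀ : Icc (0 : ℝ) 1 := ⟨0, left_mem_Icc.2 zero_le_one⟩ with ht₀
  have hPL : IsPicardLindelof F t₀ xb R 0 R K :=
    { lipschitzOnWith := hlip
      continuousOn := hcont
      norm_le := hbdd
      mul_max_le := by
        have h1 : max (1 - (t₀ : ℝ)) ((t₀ : ℝ) - 0) = 1 := by
          rw [ht₀]
          norm_num
        rw [h1]
        simp }
  have hx0 : xb ∈ closedBall xb ((0 : ℝ≥0) : ℝ) := mem_closedBall_self le_rfl
  refine ⟨Literature.Analysis.ODE.picardSolution (fun _ : Unit => hPL) hx0 (), ?_, ?_, ?_⟩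
  · exact (Literature.Analysis.ODE.picardSolution_spec (fun _ : Unit => hPL) hx0 ()).1
  · exact fun t => Literature.Analysis.ODE.picardSolution_mem_closedBall (fun _ : Unit => hPL) hx0 () t
  · exact (Literature.Analysis.ODE.picardSolution_spec (fun _ : Unit => hPL) hx0 ()).2

/-- **Uniqueness in the ball** (the "unique" of TeX l. 4059), MODEL-FREE: two solutions of `ẋ = F(t,x)` within
`[0,1]` that stay in the closed ball on which `F(t,·)` is Lipschitz and agree at `t = 0` agree on `[0,1]`
(Mathlib `ODE_solution_unique_of_mem_Icc_right`).
[cite: DimockYuan2024GNFlow, §4.5, TeX l. 4059] -/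
theorem ode_unique_of_mem_closedBall (F : ℝ → 𝕏 → 𝕏) (xb : 𝕏) (R K : ℝ≥0)
    (hlip : ∀ t ∈ Icc (0 : ℝ) 1, LipschitzOnWith K (F t) (closedBall xb R)) {x₁ x₂ : ℝ → 𝕏}
    (h₁ : ∀ t ∈ Icc (0 : ℝ) 1, HasDerivWithinAt x₁ (F t (x₁ t)) (Icc (0 : ℝ) 1) t)
    (h₁b : ∀ t ∈ Icc (0 : ℝ) 1, x₁ t ∈ closedBall xb (R : ℝ))
    (h₂ : ∀ t ∈ Icc (0 : ℝ) 1, HasDerivWithinAt x₂ (F t (x₂ t)) (Icc (0 : ℝ) 1) t)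
    (h₂b : ∀ t ∈ Icc (0 : ℝ) 1, x₂ t ∈ closedBall xb (R : ℝ)) (h0 : x₁ 0 = x₂ 0) :
    EqOn x₁ x₂ (Icc (0 : ℝ) 1) :=
  ODE_solution_unique_of_mem_Icc_right (v := F) (s := fun _ => closedBall xb (R : ℝ)) (K := K)
    (fun t ht => hlip t (mem_Icc_of_Ico ht))
    (fun t ht => (h₁ t ht).continuousWithinAt)
    (fun t ht => (h₁ t (mem_Icc_of_Ico ht)).mono_of_mem_nhdsWithin (Icc_mem_nhdsGE_of_mem ht))
    (fun t ht => h₁b t (mem_Icc_of_Ico ht))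
    (fun t ht => (h₂ t ht).continuousWithinAt)
    (fun t ht => (h₂ t (mem_Icc_of_Ico ht)).mono_of_mem_nhdsWithin (Icc_mem_nhdsGE_of_mem ht))
    (fun t ht => h₂b t (mem_Icc_of_Ico ht)) h0

end ODE

/-! ### Part 4.  (boo) + (hoo) ⇒ (stunning) (§4.5, ll. 4050–4056) -/

section Flow

variable {𝕏 : Type*} [NormedAddCommGroup 𝕏] [NormedSpace ℝ 𝕏] {X : ℕ → Type*}
  [∀ k, NormedAddCommGroup (X k)] [∀ k, NormedSpace ℝ (X k)]

/-- **(boo) + (hoo) ⇒ `x_{k+1}(t) = Φ^t_k(x_k(t))`** (TeX ll. 4050–4055, p. 67: *"Now taking the sequence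
`x_k = x_k(t)` in (boo) we have `ẋ_{k+1}(t) = D_xΦ_k(t,x_k(t))ẋ_k(t) + (0, ρ_k(x_k(t)))`.  By uniqueness of
such solutions `x_{k+1}(t) = Φ^t_k(x(t))`"*), MODEL-FREE.  Data: a normed space `𝕏` (the print's `X_w`),
components `π_k : 𝕏 →L[ℝ] X_k`, steps `Φ^t_k = Φb_k + tρ_k : X_k → X_{k+1}` with derivatives `DΦb_k`, `Dρ_k` at
the points `π_k x`, `x ∈ D` (the print's domain `x̄ + ⅛𝓑_{C_E}`, where everything is analytic), and a field `F`
satisfying the component identity (boo): `π_{k+1}F(t,x) = (DΦb_k(π_k x) + tDρ_k(π_k x))(π_k F(t,x)) + ρ_k(π_k x)`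
for `x ∈ D`, `t ∈ [0,1]`, `k < N` (in D10 this is the definition of `F = S(t,x)ρ(x)` through the solution
operator `S(t,x)` of (lumbar), `D_xΦ_k(t,x_k) = D_xΦ̄_k(x_k) + tD_xρ_k(x_k)`).  Conclusion: along any solution of
(hoo) `ẋ = F(t,x)` within `[0,1]` staying in `D`, with `π_{k+1}(x(0)) = Φb_k(π_k(x(0)))` (the initial value
`x̄` solves the approximate flow (singsong2)), `π_{k+1}(x(t)) = Φb_k(π_k x(t)) + t • ρ_k(π_k x(t))` for all
`t ∈ [0,1]`, `k < N`.
[cite: DimockYuan2024GNFlow, §4.5 (boo)–(451), TeX ll. 4035–4055] -/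
theorem flow_of_ode (π : ∀ k, 𝕏 →L[ℝ] X k) (Φb ρ : ∀ k, X k → X (k + 1))
    (DΦb Dρ : ∀ k, X k → (X k →L[ℝ] X (k + 1))) (F : ℝ → 𝕏 → 𝕏) (D : Set 𝕏) {N : ℕ}
    (hΦ : ∀ k < N, ∀ x ∈ D, HasFDerivAt (Φb k) (DΦb k (π k x)) (π k x))
    (hρ : ∀ k < N, ∀ x ∈ D, HasFDerivAt (ρ k) (Dρ k (π k x)) (π k x))
    (hboo : ∀ k < N, ∀ t ∈ Icc (0 : ℝ) 1, ∀ x ∈ D,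
      π (k + 1) (F t x) = (DΦb k (π k x) + t • Dρ k (π k x)) (π k (F t x)) + ρ k (π k x))
    {x : ℝ → 𝕏} (hxD : ∀ t ∈ Icc (0 : ℝ) 1, x t ∈ D)
    (hx : ∀ t ∈ Icc (0 : ℝ) 1, HasDerivWithinAt x (F t (x t)) (Icc (0 : ℝ) 1) t)
    (h0 : ∀ k < N, π (k + 1) (x 0) = Φb k (π k (x 0))) :
    ∀ k < N, ∀ t ∈ Icc (0 : ℝ) 1,
      π (k + 1) (x t) = Φb k (π k (x t)) + t • ρ k (π k (x t)) := by
  intro k hk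
  -- the k-th and (k+1)-st components of the path and their derivatives (hoo)
  have hxk : ∀ t ∈ Icc (0 : ℝ) 1,
      HasDerivWithinAt (fun τ => π k (x τ)) (π k (F t (x t))) (Icc (0 : ℝ) 1) t :=
    fun t ht => (π k).hasFDerivAt.comp_hasDerivWithinAt t (hx t ht)
  have hyk : ∀ t ∈ Icc (0 : ℝ) 1,
      HasDerivWithinAt (fun τ => π (k + 1) (x τ))
        ((DΦb k (π k (x t)) + t • Dρ k (π k (x t))) (π k (F t (x t))) + ρ k (π k (x t)))
        (Icc (0 : ℝ) 1) t := by
    intro t ht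
    have h := (π (k + 1)).hasFDerivAt.comp_hasDerivWithinAt t (hx t ht)
    exact h.congr_deriv (hboo k hk t ht (x t) (hxD t ht))
  exact step_eq_of_hasDerivWithinAt (Φb := Φb k) (ρ := ρ k) (DΦb := fun ξ => DΦb k ξ)
    (Dρ := fun ξ => Dρ k ξ) (x := fun τ => π k (x τ)) (x' := fun t => π k (F t (x t)))
    (y := fun τ => π (k + 1) (x τ))
    (fun t ht => hΦ k hk (x t) (hxD t ht)) (fun t ht => hρ k hk (x t) (hxD t ht)) hxk hyk (h0 k hk)

/-- **(stunning) at the endpoint** (TeX ll. 4055–4056: *"In particular `x_k ≡ x_k(1)` … satisfies (singsong1)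
`x_{k+1} = Φ_k(x_k)` and hence (stunning)"*): under the hypotheses of `flow_of_ode`, at `t = 1`,
`π_{k+1}(x(1)) = Φb_k(π_k x(1)) + ρ_k(π_k x(1))` (`= Φ_k(π_k x(1))`, `Φ^1_k = Φ_k`) for every `k < N`.
[cite: DimockYuan2024GNFlow, §4.5, TeX ll. 4055–4056] -/
theorem flow_of_ode_one (π : ∀ k, 𝕏 →L[ℝ] X k) (Φb ρ : ∀ k, X k → X (k + 1))
    (DΦb Dρ : ∀ k, X k → (X k →L[ℝ] X (k + 1))) (F : ℝ → 𝕏 → 𝕏) (D : Set 𝕏) {N : ℕ}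
    (hΦ : ∀ k < N, ∀ x ∈ D, HasFDerivAt (Φb k) (DΦb k (π k x)) (π k x))
    (hρ : ∀ k < N, ∀ x ∈ D, HasFDerivAt (ρ k) (Dρ k (π k x)) (π k x))
    (hboo : ∀ k < N, ∀ t ∈ Icc (0 : ℝ) 1, ∀ x ∈ D,
      π (k + 1) (F t x) = (DΦb k (π k x) + t • Dρ k (π k x)) (π k (F t x)) + ρ k (π k x))
    {x : ℝ → 𝕏} (hxD : ∀ t ∈ Icc (0 : ℝ) 1, x t ∈ D)
    (hx : ∀ t ∈ Icc (0 : ℝ) 1, HasDerivWithinAt x (F t (x t)) (Icc (0 : ℝ) 1) t)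
    (h0 : ∀ k < N, π (k + 1) (x 0) = Φb k (π k (x 0))) :
    ∀ k < N, π (k + 1) (x 1) = Φb k (π k (x 1)) + ρ k (π k (x 1)) := by
  intro k hk
  have h := flow_of_ode π Φb ρ DΦb Dρ F D hΦ hρ hboo hxD hx h0 k hk 1
    (right_mem_Icc.2 zero_le_one)
  simpa using h

end Flow

/-! ### Part 5.  The norm arithmetic `‖F‖ ≤ ‖S‖‖ρ‖ ≤ CC_Eh⁻² < ⅛C_E` (§4.5, ll. 4062–4070) -/

section FieldBound

variable {Xr Xw : Type*} [NormedAddCommGroup Xr] [NormedSpace ℝ Xr] [NormedAddCommGroup Xw]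
  [NormedSpace ℝ Xw]

/-- **`‖F(t,x)‖_{X_w} ≤ ‖S(t,x)‖_{𝓛(X_r,X_w)}‖ρ(x)‖_{X_r} ≤ CC_Eh⁻² < ⅛C_E`** (TeX ll. 4062–4070, p. 67–68) with the
print's *"for `h` sufficiently large"* EXPLICIT: from `‖S‖ ≤ C` (Lemma 22; the sibling's
`DimockYuan2024_lemma22_mechanism` gives `2C` for the print's `C`), `‖ρ(x)‖_{X_r} ≤ 2C_Eh⁻²` (l. 4066, from
Theorem 1 and Lemma 20) and `16C ≤ h²`, the field is bounded by the radius: `‖S ρ‖ ≤ ⅛C_E`.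
[cite: DimockYuan2024GNFlow, §4.5, TeX ll. 4062–4070] -/
theorem norm_field_le (S : Xr →L[ℝ] Xw) (r : Xr) {C CE h : ℝ} (hCE : 0 ≤ CE) (hh : 0 < h)
    (hS : ‖S‖ ≤ C) (hr : ‖r‖ ≤ 2 * CE * h⁻¹ ^ 2) (hlarge : 16 * C ≤ h ^ 2) :
    ‖S r‖ ≤ CE / 8 := by
  have hC : 0 ≤ C := le_trans (norm_nonneg S) hS
  have hh2 : 0 < h ^ 2 := by positivity
  have hinv : h⁻¹ ^ 2 = (h ^ 2)⁻¹ := by rw [inv_pow]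
  calc ‖S r‖ ≤ ‖S‖ * ‖r‖ := S.le_opNorm r
    _ ≤ C * (2 * CE * h⁻¹ ^ 2) :=
        mul_le_mul hS hr (norm_nonneg r) hC
    _ = (16 * C) * CE / (8 * h ^ 2) := by
        rw [hinv]
        field_simp
        ring
    _ ≤ h ^ 2 * CE / (8 * h ^ 2) := by
        apply div_le_div_of_nonneg_right _ (by positivity)
        exact mul_le_mul_of_nonneg_right hlarge hCE
    _ = CE / 8 := by
        field_simp

end FieldBound

/-! ### Part 6.  Assembly: Theorem 4's mechanism (§4.5, ll. 4033–4078), model-free -/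

section Assembly

universe u

variable {𝕏 : Type u} [NormedAddCommGroup 𝕏] [NormedSpace ℝ 𝕏] [CompleteSpace 𝕏] {X : ℕ → Type*}
  [∀ k, NormedAddCommGroup (X k)] [∀ k, NormedSpace ℝ (X k)]

/-- **Theorem 4's mechanism, MODEL-FREE** (D10 §4.5, TeX ll. 4033–4078, pp. 67–68).  Let `𝕏` be a real Banach
space (the print's `X_w`) with components `π_k : 𝕏 →L[ℝ] X_k`, steps `Φ_k = Φb_k + ρ_k` interpolated by
`Φ^t_k = Φb_k + tρ_k` with `Φb_k`, `ρ_k` differentiable at the points `π_k x` of the closed ball of radius `R`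
about `x̄` (the print's `x̄ + ⅛𝓑_{C_E}`), and a field `F : [0,1] × 𝕏 → 𝕏` (the print's `S(t,x)ρ(x)`) which on
that ball is `K`-Lipschitz in `x`, continuous in `t`, bounded in norm by `R` (ll. 4058–4070) and satisfies the
component identity (boo) (l. 4037).  Suppose `x̄` solves the approximate flow, `π_{k+1}x̄ = Φb_k(π_k x̄)`
((singsong2), l. 3455).  THEN there is a path `x : [0,1] → 𝕏` with `x(0) = x̄`, confined to the ball, solving
(hoo) `ẋ = F(t,x)` within `[0,1]`, whose endpoint `x(1)` — *"still in `x̄ + ⅛𝓑_{C_E}`"* — solves the FULL flow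
(singsong1)/(stunning) `π_{k+1}x(1) = Φb_k(π_k x(1)) + ρ_k(π_k x(1))` for every `k < N`, and which keeps every
boundary value: `b(x(1)) = b(x̄)` for every continuous linear `b : 𝕏 →L[ℝ] Z` with `b ∘ F(t,·) = 0` on the ball
(the null boundary conditions of `S(t,x)ρ(x)`, ll. 4045–4048; (BC) l. 3292) — `Z` ranging over the universe of `𝕏`
so that the statement carries no stray universe parameter (v1.1, XREAD C-lit2g20-3 I5); for a target in another
universe apply `apply_eq_of_null_deriv` to the returned path.  What is hypothesis here and
theorem in print: the Lipschitz/continuity/bound properties of D10's `F = S(t,x)ρ(x)` (ll. 4062–4076: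
Theorem 1, Lemma 20, Lemma 22, analyticity).
[cite: DimockYuan2024GNFlow, Theorem 4 via §4.5, TeX ll. 4033–4078] -/
theorem DimockYuan2024_thm4_mechanism (π : ∀ k, 𝕏 →L[ℝ] X k) (Φb ρ : ∀ k, X k → X (k + 1))
    (DΦb Dρ : ∀ k, X k → (X k →L[ℝ] X (k + 1))) (F : ℝ → 𝕏 → 𝕏) (xb : 𝕏) (R K : ℝ≥0) {N : ℕ}
    (hlip : ∀ t ∈ Icc (0 : ℝ) 1, LipschitzOnWith K (F t) (closedBall xb R))
    (hcont : ∀ x ∈ closedBall xb (R : ℝ), ContinuousOn (F · x) (Icc (0 : ℝ) 1))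
    (hbdd : ∀ t ∈ Icc (0 : ℝ) 1, ∀ x ∈ closedBall xb (R : ℝ), ‖F t x‖ ≤ R)
    (hΦ : ∀ k < N, ∀ x ∈ closedBall xb (R : ℝ), HasFDerivAt (Φb k) (DΦb k (π k x)) (π k x))
    (hρ : ∀ k < N, ∀ x ∈ closedBall xb (R : ℝ), HasFDerivAt (ρ k) (Dρ k (π k x)) (π k x))
    (hboo : ∀ k < N, ∀ t ∈ Icc (0 : ℝ) 1, ∀ x ∈ closedBall xb (R : ℝ),
      π (k + 1) (F t x) = (DΦb k (π k x) + t • Dρ k (π k x)) (π k (F t x)) + ρ k (π k x))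
    (hfix : ∀ k < N, π (k + 1) xb = Φb k (π k xb)) :
    ∃ x : ℝ → 𝕏, x 0 = xb ∧ (∀ t, x t ∈ closedBall xb (R : ℝ)) ∧
      (∀ t ∈ Icc (0 : ℝ) 1, HasDerivWithinAt x (F t (x t)) (Icc (0 : ℝ) 1) t) ∧
      (∀ k < N, π (k + 1) (x 1) = Φb k (π k (x 1)) + ρ k (π k (x 1))) ∧
      ∀ {Z : Type u} [NormedAddCommGroup Z] [NormedSpace ℝ Z] (b : 𝕏 →L[ℝ] Z),
        (∀ t ∈ Icc (0 : ℝ) 1, ∀ y ∈ closedBall xb (R : ℝ), b (F t y) = 0) → b (x 1) = b xb := by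
  obtain ⟨x, hx0, hxball, hx⟩ := ode_exists_mem_closedBall F xb R K hlip hcont hbdd
  refine ⟨x, hx0, hxball, hx, ?_, ?_⟩
  · have h0 : ∀ k < N, π (k + 1) (x 0) = Φb k (π k (x 0)) := by
      intro k hk
      rw [hx0]
      exact hfix k hk
    exact flow_of_ode_one π Φb ρ DΦb Dρ F (closedBall xb (R : ℝ)) hΦ hρ hboo
      (fun t _ => hxball t) hx h0
  · intro Z _ _ b hb
    have h := apply_eq_of_null_deriv b (x' := fun t => F t (x t)) hx
      (fun t ht => hb t (mem_Icc_of_Ico ht) (x t) (hxball t)) 1 (right_mem_Icc.2 zero_le_one)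
    rw [h, hx0]

end Assembly

end Literature.MathematicalPhysics.QuantumFieldTheory.DimockYuan2024.FlowReduction
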